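/-
Copyright: H21 K2-LIT squad (hodgecm-mathlib). Helper for crux hLiu418 = `stmt-HodgeConjecture-24832`
(route `route-HodgeConjecture-HCCMUnconditional`), G-road arch debt «(D-ht)» (LEAD ruling «M-156h», G2-PS-B, file B3 definitions).
-/
import Summits.HodgeConjecture.HodgeConjecture.Theorems.K2LiuSiegelGramDeterminantDefs                -- ★ `siegelGram`
import Literature.NumberTheory.K2Lit.SiegelStandardExtension                                          -- ★ `IwasawaDatum.kPart`
import Literature.NumberTheory.GelbartRogawski1991.DoubledUnitaryArchSiegelDiagonalModulus          -- ★ `placeOver`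
import Literature.NumberTheory.Automorphic.UnitaryGroupAdelicProduct                                 -- ★ `archPart`
import Literature.NumberTheory.Automorphic.UnitaryGroupArchimedeanPlaces                              -- ★ `evalC`
import Mathlib.Analysis.Matrix.Normed
import Mathlib.Analysis.Calculus.FDeriv.Basic
import HarnessLib

/-!
# The archimedean Gram height function and the height log-derivative — definitions

For the doubled unitary group `H = U(𝕍 ⊕ −𝕍)` over the CM field `L`, a frame `S ∈ GL_{2n}(L ⊗ ℝ)` (the majorant frame of a STANDARD
Iwasawa datum, ★ `IwasawaDatum.IsStd` (P2)) and `c ∈ GL_{2n}(L ⊗ ℝ)`: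

* `gramHeightFun S c : M_{2n}(L ⊗ ℝ) → ℝ`,
  `gramHeightFun S c Y = √(∏_{v real ∣ L⁺} siegelGram S_{w(v)}⁻¹ 1 ∕ siegelGram S_{w(v)}⁻¹ (Y_{w(v)} · c_{w(v)}⁻¹))` (real parts; `w(v) = placeOver v`,
  components by ★ `evalC`) — by ★ `K2LiuIwasawaHeightArchReduction.iwasawaHeight_archEmb_sq`, for `c ∈ C_∞` and `Y = exp(−tX)` this is the Iwasawa
  height `Φ_𝒦((c·exp tX, 1))`, now as a function on the whole matrix space (so that it has a Fréchet derivative at `Y = 1`);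
* `heightDeriv 𝒦 S X h := (fderiv ℝ (gramHeightFun S c_h) 1) (−X)` with `c_h = (𝒦.kPart h)_∞` — the height log-derivative
  `H_X(h) = d/dt|₀ log Φ_𝒦(h · γ_X t)` (theorem `hasDerivAt_iwasawaHeight_orbit` of the companion file), `ℝ`-linear in `X`.

The matrix space carries the operator (`L∞–L¹`) norm `Matrix.Norms.Operator`, the setting of Mathlib's matrix exponential; `fderiv` refers to it.
[cite: KudlaRallis1994, §1] [cite: Weil1964, Chap. I n° 8] [cite: Knapp2002, 0.§2]
-/

set_option linter.dupNamespace false -- the mandated namespace repeats `HodgeConjecture.HodgeConjecture`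

open Literature.NumberTheory.Automorphic Literature.NumberTheory.Automorphic.UnitaryGroup
open Literature.NumberTheory.GaloisRepresentations
open Literature.NumberTheory.GelbartRogawski1991 Literature.NumberTheory.GelbartRogawski1991.GRConstruction
open Literature.NumberTheory.K2Lit.SiegelDoubled
open Summit.HodgeConjecture.HodgeConjecture.Cruxes.HLiu418.K2LiuSiegelGramDeterminantDefs
-- `Classical` is needed to see the Mathlib normed-space instances on `mixedSpace L` (note H5 of `AdelicGLnGlue`)
open scoped Classical
open scoped Matrix Matrix.Norms.Operator
open NumberField NumberField.mixedEmbedding NumberField.InfinitePlace IsDedekindDomain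

namespace Summit.HodgeConjecture.HodgeConjecture.Cruxes.HLiu418.K2LiuIwasawaHeightLieDerivativeDefs

variable (L : Type) [Field L] [NumberField L] [IsCMField L]
variable {n : ℕ}

/-- **the archimedean Gram height function** of the frame `S` at the base point `c`:
`Y ↦ √(∏_v Re siegelGram S_v⁻¹ 1 ∕ Re siegelGram S_v⁻¹ (Y_v c_v⁻¹))` on `M_{2n}(L ⊗ ℝ)`. [cite: KudlaRallis1994, §1] [cite: Weil1964, Chap. I n° 8] -/
noncomputable def gramHeightFun (S c : GL (Fin (n + n)) (mixedSpace L)) (Y : Matrix (Fin (n + n)) (Fin (n + n)) (mixedSpace L)) : ℝ :=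
  Real.sqrt (∏ v : {v : InfinitePlace (Fp L) // v.IsReal},
    (siegelGram (((Matrix.GeneralLinearGroup.map (evalC L (placeOver L v)) S)⁻¹ : GL (Fin (n + n)) ℂ) :
        Matrix (Fin (n + n)) (Fin (n + n)) ℂ) 1).re /
      (siegelGram (((Matrix.GeneralLinearGroup.map (evalC L (placeOver L v)) S)⁻¹ : GL (Fin (n + n)) ℂ) :
          Matrix (Fin (n + n)) (Fin (n + n)) ℂ)
        (Y.map (evalC L (placeOver L v)) *
          (((Matrix.GeneralLinearGroup.map (evalC L (placeOver L v)) c)⁻¹ : GL (Fin (n + n)) ℂ) :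
            Matrix (Fin (n + n)) (Fin (n + n)) ℂ))).re)

/-- unfolding of `gramHeightFun`. [cite: KudlaRallis1994, §1] -/
theorem gramHeightFun_def (S c : GL (Fin (n + n)) (mixedSpace L)) (Y : Matrix (Fin (n + n)) (Fin (n + n)) (mixedSpace L)) :
    gramHeightFun L S c Y = Real.sqrt (∏ v : {v : InfinitePlace (Fp L) // v.IsReal},
      (siegelGram (((Matrix.GeneralLinearGroup.map (evalC L (placeOver L v)) S)⁻¹ : GL (Fin (n + n)) ℂ) :
          Matrix (Fin (n + n)) (Fin (n + n)) ℂ) 1).re /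
        (siegelGram (((Matrix.GeneralLinearGroup.map (evalC L (placeOver L v)) S)⁻¹ : GL (Fin (n + n)) ℂ) :
            Matrix (Fin (n + n)) (Fin (n + n)) ℂ)
          (Y.map (evalC L (placeOver L v)) *
            (((Matrix.GeneralLinearGroup.map (evalC L (placeOver L v)) c)⁻¹ : GL (Fin (n + n)) ℂ) :
              Matrix (Fin (n + n)) (Fin (n + n)) ℂ))).re) := rfl

variable {L}
variable {N M : ℕ} {e : Fin N × Fin M ≃ Fin n}
  {dV : Fin N → L} {hdV : ∀ i, IsCMField.complexConj L (dV i) = dV i}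
  {dW : Fin M → L} {hdW : ∀ i, IsCMField.complexConj L (dW i) = dW i}

/-- **the height log-derivative** `H_X(h) := (D gramHeightFun_{S, c_h})(1)(−X)` with `c_h = (𝒦.kPart h)_∞` the archimedean component of the
`K`-part of `h` — the value of `d/dt|₀ log Φ_𝒦(h · γ_X t)` (companion file), manifestly `ℝ`-linear in `X`.
[cite: KudlaRallis1994, §1] [cite: Knapp2002, 0.§2] -/
noncomputable def heightDeriv (𝒦 : IwasawaDatum L e dV hdV dW hdW) (S : GL (Fin (n + n)) (mixedSpace L))
    (X : Matrix (Fin (n + n)) (Fin (n + n)) (mixedSpace L)) (h : HA L e dV hdV dW hdW) : ℝ :=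
  (fderiv ℝ (gramHeightFun L S (archPart (Fp L) L (IsCMField.complexConj L) (n + n) (hermD L e dV hdV dW hdW) (𝒦.kPart h) :
      GL (Fin (n + n)) (mixedSpace L))) 1) (-X)

/-- unfolding of `heightDeriv`. [cite: KudlaRallis1994, §1] -/
theorem heightDeriv_def (𝒦 : IwasawaDatum L e dV hdV dW hdW) (S : GL (Fin (n + n)) (mixedSpace L))
    (X : Matrix (Fin (n + n)) (Fin (n + n)) (mixedSpace L)) (h : HA L e dV hdV dW hdW) :
    heightDeriv 𝒦 S X h =
      (fderiv ℝ (gramHeightFun L S (archPart (Fp L) L (IsCMField.complexConj L) (n + n) (hermD L e dV hdV dW hdW) (𝒦.kPart h) :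
        GL (Fin (n + n)) (mixedSpace L))) 1) (-X) := rfl

/-- `heightDeriv` is additive in `X` (a continuous linear map evaluated at `−X`). [cite: Knapp2002, 0.§2] -/
theorem heightDeriv_add (𝒦 : IwasawaDatum L e dV hdV dW hdW) (S : GL (Fin (n + n)) (mixedSpace L))
    (X X' : Matrix (Fin (n + n)) (Fin (n + n)) (mixedSpace L)) (h : HA L e dV hdV dW hdW) :
    heightDeriv 𝒦 S (X + X') h = heightDeriv 𝒦 S X h + heightDeriv 𝒦 S X' h := by
  simp only [heightDeriv, neg_add, map_add]

/-- `heightDeriv` is `ℝ`-homogeneous in `X`. [cite: Knapp2002, 0.§2] -/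
theorem heightDeriv_smul (𝒦 : IwasawaDatum L e dV hdV dW hdW) (S : GL (Fin (n + n)) (mixedSpace L)) (r : ℝ)
    (X : Matrix (Fin (n + n)) (Fin (n + n)) (mixedSpace L)) (h : HA L e dV hdV dW hdW) :
    heightDeriv 𝒦 S (r • X) h = r * heightDeriv 𝒦 S X h := by
  simp only [heightDeriv, ← smul_neg, map_smul, smul_eq_mul]

end Summit.HodgeConjecture.HodgeConjecture.Cruxes.HLiu418.K2LiuIwasawaHeightLieDerivativeDefs
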